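import Summits.BirchSwinnertonDyer.Rank1Residual.GaloisImage.KatoKuriharaValueOfComparison
import Literature.NumberTheory.EllipticCurves.KuriharaNumber
import HarnessLib

/-!
# The integral twist `V` of PK-4b-C4b-2 (v): unit augmentation from END-m1's certificates, and its
# INTEGRAL LIFT (ROW T-PK6-VDIS FILE 2; cell `b2b-bsdres`, team n1011, seat p02 GEN 14 → GEN 15)

HONEST FRAMING (cell `b2b-bsdres`, run/shared/lean/b2b/bsd-rank1-residual/, verbatim in every
file): the goal of the cell is to DELETE the COMBINATION-SHAPED residual classes of the
Birch–Swinnerton-Dyer formula for ALL analytic-rank `≤ 1` elliptic curves over `ℚ` — "full BSD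
formula for every rank `≤ 1` curve in class `C`" assembled STRICTLY from published theorems — so
that the rank-`≤ 1` remainder becomes exactly the CONSTRUCTION-SHAPED classes, which are TYPED
(missing-input `Prop`s), NOT attempted. This is not "finishing BSD". Team n1011 (N10/N11; ROUTE 1,
the PORT anatomy (P-KIM) of class X4 ∧ `p = 3`): research route on CONSTRUCTION-SHAPED classes;
prove what is provable now; no claim beyond stated classes; census output = EVIDENCE, never a
Literature fact; RESIDUAL-MAP marks UNCHANGED; nothing is booked by this file. TOOL THEOREMS ONLY:
no definition, no named fact, no instance, no `sorry`.

## What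

T-PK6-VROW FILE 1 (`KatoKuriharaValueRowOfComparison`, ★★ `ValueRow.exists_valueRow_of_mem_map_span`)
displays ONE certificate-type binder on the value side: `hV : IsUnit (Σ_g V.coeff g)` — the unit
AUGMENTATION of the integral twist `V ∈ ℤ_p[(ℤ/n)ˣ]` of PK-4b-C4b-2 (v) (`V^{ℚ_p} = Vq^{ℚ_p}`,
`Vq = (1 + δ₋₁) · δ_{u⁻¹} uκ · Eq · Cq`).  The augmentation `X ↦ Σ_g X_g` is the algebra map
`MonoidAlgebra.lift ℚ ℚ G 1` (§1: multiplicative, `aug (single a r) = r`, `aug ∘ mapRingHom φ = φ ∘ aug`),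
so `aug Vq = 2 · uκ · aug Eq · aug Cq` with `aug Eq = ∏_{q ∣ pA} (1 − a_q/q + 𝟙_{q∤N}/q)` (= END-m1's
depletion factor `E`) and `aug Cq = c²d²[a/A]⁻ − cd²[ac/A]⁻ − c²d[ad′/A]⁻ + cd[acd′/A]⁻` (= END-m1's
`R⁻`): **the general-level value row costs NO certificate beyond END-m1's** (`hNorm`/`hE`/`hR` of
`KatoValue.apply_localization_eq_unit_mul_kuriharaNumber_one`, plus `p ≠ 2`).  §3–§4: the EXISTENCE of
the integral lift `V` (C4b-2 (v)'s displayed `hV : V^{ℚ_p} = Vq^{ℚ_p}`): the rational group-ring elements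
whose base change to `ℚ_p` comes from `ℤ_p[G]` form a subring (`Subring.comap` of the range of
`mapRingHom ℤ_p → ℚ_p`) containing every monomial with a `p`-integral coefficient, so `Vq` lifts as soon
as the scalars `uκ`, `a_q/q`, `𝟙_{q∤N}/q` (`q ∣ M`) and the four cusp symbols are `p`-integral
(`exists_padicLift_twist`; cf. n1011-p15's coefficientwise twins `EulerFactorComparison.exists_lift_*`
in `KatoZetaValueDerivativeCongruence`).  0 defs / 0 facts.
-/

noncomputable section

open scoped BigOperators
open Finset

namespace Summit.BirchSwinnertonDyer.Rank1Residual.GaloisImage.ValueRow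

/-! ### §1 The augmentation `X ↦ Σ_g X_g` of a finite group ring -/
section Augmentation

variable {R : Type*} [CommRing R] {G : Type*} [CommGroup G] [Fintype G]

/-- The augmentation `Σ_g X_g` is the algebra map `MonoidAlgebra.lift R R G 1` (trivial character).
[folklore] -/
theorem sum_coeff_eq_lift_one (X : MonoidAlgebra R G) :
    ∑ g : G, X.coeff g = MonoidAlgebra.lift R R G (1 : G →* R) X := by
  classical
  rw [MonoidAlgebra.lift_apply, Finsupp.sum_fintype _ _ (fun g => by simp)]
  simp

/-- The augmentation is multiplicative. [folklore] -/
theorem sum_coeff_mul (X Y : MonoidAlgebra R G) :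
    ∑ g : G, (X * Y).coeff g = (∑ g : G, X.coeff g) * ∑ g : G, Y.coeff g := by
  rw [sum_coeff_eq_lift_one, sum_coeff_eq_lift_one, sum_coeff_eq_lift_one, map_mul]

/-- The augmentation of a finite product. [folklore] -/
theorem sum_coeff_prod {ι : Type*} (s : Finset ι) (X : ι → MonoidAlgebra R G) :
    ∑ g : G, (∏ i ∈ s, X i).coeff g = ∏ i ∈ s, ∑ g : G, (X i).coeff g := by
  simp_rw [sum_coeff_eq_lift_one, map_prod]

/-- `aug (single a r) = r`. [folklore] -/
theorem sum_coeff_single (a : G) (r : R) : ∑ g : G, (MonoidAlgebra.single a r).coeff g = r := by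
  rw [sum_coeff_eq_lift_one, MonoidAlgebra.lift_single]
  simp

/-- `aug 1 = 1`. [folklore] -/
theorem sum_coeff_one : ∑ g : G, (1 : MonoidAlgebra R G).coeff g = 1 := by
  rw [sum_coeff_eq_lift_one, map_one]

/-- `aug (algebraMap r) = r`. [folklore] -/
theorem sum_coeff_algebraMap (r : R) : ∑ g : G, (algebraMap R (MonoidAlgebra R G) r).coeff g = r := by
  rw [sum_coeff_eq_lift_one, AlgHom.commutes]
  rfl

/-- The augmentation is additive. [folklore] -/
theorem sum_coeff_add (X Y : MonoidAlgebra R G) :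
    ∑ g : G, (X + Y).coeff g = (∑ g : G, X.coeff g) + ∑ g : G, Y.coeff g := by
  rw [sum_coeff_eq_lift_one, sum_coeff_eq_lift_one, sum_coeff_eq_lift_one, map_add]

/-- The augmentation commutes with subtraction. [folklore] -/
theorem sum_coeff_sub (X Y : MonoidAlgebra R G) :
    ∑ g : G, (X - Y).coeff g = (∑ g : G, X.coeff g) - ∑ g : G, Y.coeff g := by
  rw [sum_coeff_eq_lift_one, sum_coeff_eq_lift_one, sum_coeff_eq_lift_one, map_sub]

omit [Fintype G] in
/-- The augmentation commutes with a change of coefficients. [folklore] -/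
theorem sum_coeff_mapRingHom [Fintype G] {S : Type*} [CommRing S] (φ : R →+* S) (X : MonoidAlgebra R G) :
    ∑ g : G, (MonoidAlgebra.mapRingHom G φ X).coeff g = φ (∑ g : G, X.coeff g) := by
  rw [map_sum]
  exact Finset.sum_congr rfl fun g _ => MonoidAlgebra.coeff_mapRingHom φ X g

end Augmentation

/-! ### §2 The augmentation of PK-4b-C's twist and its unit certificate -/

variable (p : ℕ) [Fact p.Prime] {n : ℕ} [NeZero n]

/-- **The augmentation of the rational twist `Vq = (1 + δ₋₁) · δ_{u⁻¹} uκ · Eq · Cq`** (PK-4b-C4b-2 (v)'s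
`hVq` / `hEq` / `hCq` shapes): `aug Vq = 2 · uκ · ∏_{q ∣ pA}(1 − a_q/q + 𝟙_{q∤N}/q) · R⁻` with
`R⁻ = c²d²[a/A]⁻ − cd²[ac/A]⁻ − c²d[ad′/A]⁻ + cd[acd′/A]⁻` — END-m1's depletion factor and cusp factor.
[cite: Kato2004Asterisque, Thm. 6.6 (1) (p. 163) and §6.2 (p. 161)] -/
theorem sum_coeff_twist_eq {N₀ : ℕ} (f : CuspForm (CongruenceSubgroup.Gamma0 N₀) 2)
    (u : (ZMod n)ˣ) (uκ : ℚ) (M N : ℕ) (uq : ℕ → (ZMod n)ˣ) (aM : ℕ → ℤ)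
    (Eq : MonoidAlgebra ℚ (ZMod n)ˣ)
    (hEq : Eq = ∏ q ∈ M.primeFactors, (1 - MonoidAlgebra.single (uq q)⁻¹ ((aM q : ℚ) / q) +
      MonoidAlgebra.single ((uq q)⁻¹ ^ 2) (if q ∣ N then 0 else (1 / q : ℚ))))
    (c d a d' : ℤ) (A : ℕ) (uc ud : (ZMod n)ˣ)
    (Cq : MonoidAlgebra ℚ (ZMod n)ˣ)
    (hCq : Cq = algebraMap ℚ _ ((c : ℚ) ^ 2 * (d : ℚ) ^ 2 * Literature.NumberTheory.EllipticCurves.ratMinusSymbol f ((a : ℚ) / A)) -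
      MonoidAlgebra.single uc ((c : ℚ) * (d : ℚ) ^ 2 * Literature.NumberTheory.EllipticCurves.ratMinusSymbol f ((a * c : ℚ) / A)) -
      MonoidAlgebra.single ud ((c : ℚ) ^ 2 * (d : ℚ) * Literature.NumberTheory.EllipticCurves.ratMinusSymbol f ((a * d' : ℚ) / A)) +
      MonoidAlgebra.single (uc * ud) ((c : ℚ) * (d : ℚ) * Literature.NumberTheory.EllipticCurves.ratMinusSymbol f ((a * c * d' : ℚ) / A)))
    (Vq : MonoidAlgebra ℚ (ZMod n)ˣ)
    (hVq : Vq = (1 + MonoidAlgebra.single (-1 : (ZMod n)ˣ) (1 : ℚ)) * MonoidAlgebra.single u⁻¹ uκ * Eq * Cq) :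
    ∑ g : (ZMod n)ˣ, Vq.coeff g = 2 * uκ *
      (∏ q ∈ M.primeFactors, (1 - (aM q : ℚ) / q + (if q ∣ N then 0 else (1 / q : ℚ)))) *
      ((c : ℚ) ^ 2 * (d : ℚ) ^ 2 * Literature.NumberTheory.EllipticCurves.ratMinusSymbol f ((a : ℚ) / A) -
        (c : ℚ) * (d : ℚ) ^ 2 * Literature.NumberTheory.EllipticCurves.ratMinusSymbol f ((a * c : ℚ) / A) -
        (c : ℚ) ^ 2 * (d : ℚ) * Literature.NumberTheory.EllipticCurves.ratMinusSymbol f ((a * d' : ℚ) / A) +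
        (c : ℚ) * (d : ℚ) * Literature.NumberTheory.EllipticCurves.ratMinusSymbol f ((a * c * d' : ℚ) / A)) := by
  subst hVq hEq hCq
  rw [sum_coeff_mul, sum_coeff_mul, sum_coeff_mul, sum_coeff_add, sum_coeff_one, sum_coeff_single,
    sum_coeff_single, sum_coeff_prod]
  congr 1
  · congr 1
    · norm_num
    · exact Finset.prod_congr rfl fun q _ => by
        rw [sum_coeff_add, sum_coeff_sub, sum_coeff_one, sum_coeff_single, sum_coeff_single]
  · rw [sum_coeff_add, sum_coeff_sub, sum_coeff_sub, sum_coeff_algebraMap, sum_coeff_single, sum_coeff_single,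
      sum_coeff_single]

/-- **The integral twist has unit augmentation** (T-PK6-VROW FILE 1 ★★'s `hV`) as soon as its rational
model has `p`-adic valuation zero: `V^{ℚ_p} = Vq^{ℚ_p}` (`hV`, C4b-2 (v)'s integral-lift binder),
`aug Vq ≠ 0`, `padicValRat p (aug Vq) = 0`. [folklore] -/
theorem isUnit_sum_coeff_of_padicValRat_eq_zero (V : MonoidAlgebra ℤ_[p] (ZMod n)ˣ)
    (Vq : MonoidAlgebra ℚ (ZMod n)ˣ)
    (hV : MonoidAlgebra.mapRingHom (ZMod n)ˣ (PadicInt.Coe.ringHom (p := p)) V =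
      MonoidAlgebra.mapRingHom (ZMod n)ˣ (algebraMap ℚ ℚ_[p]) Vq)
    (h0 : ∑ g : (ZMod n)ˣ, Vq.coeff g ≠ 0) (hval : padicValRat p (∑ g : (ZMod n)ˣ, Vq.coeff g) = 0) :
    IsUnit (∑ g : (ZMod n)ˣ, V.coeff g) := by
  have h := congrArg (fun Y : MonoidAlgebra ℚ_[p] (ZMod n)ˣ => ∑ g : (ZMod n)ˣ, Y.coeff g) hV
  simp only [sum_coeff_mapRingHom] at h
  rw [PadicInt.isUnit_iff, PadicInt.norm_def]
  have h' : ((∑ g : (ZMod n)ˣ, V.coeff g : ℤ_[p]) : ℚ_[p]) = ((∑ g : (ZMod n)ˣ, Vq.coeff g : ℚ) : ℚ_[p]) := by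
    simpa using h
  rw [h', Padic.norm_eq_zpow_neg_valuation (by exact_mod_cast h0), Padic.valuation_ratCast, hval, neg_zero,
    zpow_zero]

/-- **★ END-m1's three certificates give FILE 1 ★★'s `hV` at EVERY tame level**: `p ≠ 2`,
`uκ ≠ 0 ∧ v_p(uκ) = 0` (R-κ (b)), the depletion factor `E = ∏_{q∣pA}(1 − a_q/q + 𝟙_{q∤N}/q)` with
`E ≠ 0 ∧ v_p(E) = 0`, the cusp factor `R⁻ ≠ 0 ∧ v_p(R⁻) = 0` ⟹ `IsUnit (Σ_g V.coeff g)` for the integral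
twist `V` of C4b-2 (v). [cite: Kim2022StructureSelmer, the proof of Thm. 3.13 (arXiv v3 pp. 26–28; = Thm. 3.11 of AJM 148)] -/
theorem isUnit_sum_coeff_twist_of_certificates (hp2 : p ≠ 2) {N₀ : ℕ}
    (f : CuspForm (CongruenceSubgroup.Gamma0 N₀) 2)
    (u : (ZMod n)ˣ) (uκ : ℚ) (M N : ℕ) (uq : ℕ → (ZMod n)ˣ) (aM : ℕ → ℤ)
    (Eq : MonoidAlgebra ℚ (ZMod n)ˣ)
    (hEq : Eq = ∏ q ∈ M.primeFactors, (1 - MonoidAlgebra.single (uq q)⁻¹ ((aM q : ℚ) / q) +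
      MonoidAlgebra.single ((uq q)⁻¹ ^ 2) (if q ∣ N then 0 else (1 / q : ℚ))))
    (c d a d' : ℤ) (A : ℕ) (uc ud : (ZMod n)ˣ)
    (Cq : MonoidAlgebra ℚ (ZMod n)ˣ)
    (hCq : Cq = algebraMap ℚ _ ((c : ℚ) ^ 2 * (d : ℚ) ^ 2 * Literature.NumberTheory.EllipticCurves.ratMinusSymbol f ((a : ℚ) / A)) -
      MonoidAlgebra.single uc ((c : ℚ) * (d : ℚ) ^ 2 * Literature.NumberTheory.EllipticCurves.ratMinusSymbol f ((a * c : ℚ) / A)) -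
      MonoidAlgebra.single ud ((c : ℚ) ^ 2 * (d : ℚ) * Literature.NumberTheory.EllipticCurves.ratMinusSymbol f ((a * d' : ℚ) / A)) +
      MonoidAlgebra.single (uc * ud) ((c : ℚ) * (d : ℚ) * Literature.NumberTheory.EllipticCurves.ratMinusSymbol f ((a * c * d' : ℚ) / A)))
    (Vq : MonoidAlgebra ℚ (ZMod n)ˣ)
    (hVq : Vq = (1 + MonoidAlgebra.single (-1 : (ZMod n)ˣ) (1 : ℚ)) * MonoidAlgebra.single u⁻¹ uκ * Eq * Cq)
    (V : MonoidAlgebra ℤ_[p] (ZMod n)ˣ)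
    (hV : MonoidAlgebra.mapRingHom (ZMod n)ˣ (PadicInt.Coe.ringHom (p := p)) V =
      MonoidAlgebra.mapRingHom (ZMod n)ˣ (algebraMap ℚ ℚ_[p]) Vq)
    (huκ0 : uκ ≠ 0) (huκ : padicValRat p uκ = 0)
    (hE0 : ∏ q ∈ M.primeFactors, (1 - (aM q : ℚ) / q + (if q ∣ N then 0 else (1 / q : ℚ))) ≠ 0)
    (hE : padicValRat p (∏ q ∈ M.primeFactors, (1 - (aM q : ℚ) / q + (if q ∣ N then 0 else (1 / q : ℚ)))) = 0)
    (hR0 : (c : ℚ) ^ 2 * (d : ℚ) ^ 2 * Literature.NumberTheory.EllipticCurves.ratMinusSymbol f ((a : ℚ) / A) -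
        (c : ℚ) * (d : ℚ) ^ 2 * Literature.NumberTheory.EllipticCurves.ratMinusSymbol f ((a * c : ℚ) / A) -
        (c : ℚ) ^ 2 * (d : ℚ) * Literature.NumberTheory.EllipticCurves.ratMinusSymbol f ((a * d' : ℚ) / A) +
        (c : ℚ) * (d : ℚ) * Literature.NumberTheory.EllipticCurves.ratMinusSymbol f ((a * c * d' : ℚ) / A) ≠ 0)
    (hR : padicValRat p ((c : ℚ) ^ 2 * (d : ℚ) ^ 2 * Literature.NumberTheory.EllipticCurves.ratMinusSymbol f ((a : ℚ) / A) -
        (c : ℚ) * (d : ℚ) ^ 2 * Literature.NumberTheory.EllipticCurves.ratMinusSymbol f ((a * c : ℚ) / A) -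
        (c : ℚ) ^ 2 * (d : ℚ) * Literature.NumberTheory.EllipticCurves.ratMinusSymbol f ((a * d' : ℚ) / A) +
        (c : ℚ) * (d : ℚ) * Literature.NumberTheory.EllipticCurves.ratMinusSymbol f ((a * c * d' : ℚ) / A)) = 0) :
    IsUnit (∑ g : (ZMod n)ˣ, V.coeff g) := by
  haveI : Fact p.Prime := inferInstance
  have haug := sum_coeff_twist_eq f u uκ M N uq aM Eq hEq c d a d' A uc ud Cq hCq Vq hVq
  refine isUnit_sum_coeff_of_padicValRat_eq_zero p V Vq hV ?_ ?_
  · rw [haug]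
    exact mul_ne_zero (mul_ne_zero (mul_ne_zero two_ne_zero huκ0) hE0) hR0
  · rw [haug, padicValRat.mul (mul_ne_zero (mul_ne_zero two_ne_zero huκ0) hE0) hR0,
      padicValRat.mul (mul_ne_zero two_ne_zero huκ0) hE0, padicValRat.mul two_ne_zero huκ0, huκ, hE, hR]
    have h2 : padicValRat p 2 = 0 := by
      rw [show (2 : ℚ) = ((2 : ℕ) : ℚ) by norm_num, padicValRat.of_nat]
      norm_cast
      exact padicValNat.eq_zero_of_not_dvd fun h =>
        hp2 ((Nat.prime_dvd_prime_iff_eq Fact.out Nat.prime_two).1 h)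
    rw [h2]
    ring

/-! ### §3 Integral lifts along `ℤ_p[G] → ℚ_p[G]` -/

section Lift

variable {G : Type*} [CommGroup G]

/-- A monomial with a `p`-integral rational coefficient lifts to `ℤ_p[G]`. [folklore] -/
theorem single_algebraMap_mem_range_mapRingHom (g : G) {q : ℚ} (h : ‖(q : ℚ_[p])‖ ≤ 1) :
    MonoidAlgebra.single g (algebraMap ℚ ℚ_[p] q) ∈
      (MonoidAlgebra.mapRingHom G (PadicInt.Coe.ringHom (p := p))).range := by
  refine ⟨MonoidAlgebra.single g ⟨(q : ℚ_[p]), h⟩, ?_⟩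
  rw [MonoidAlgebra.mapRingHom_single, eq_ratCast]
  rfl

/-- A constant with a `p`-integral rational value lifts to `ℤ_p[G]`. [folklore] -/
theorem algebraMap_mem_range_mapRingHom {q : ℚ} (h : ‖(q : ℚ_[p])‖ ≤ 1) :
    MonoidAlgebra.mapRingHom G (algebraMap ℚ ℚ_[p]) (algebraMap ℚ (MonoidAlgebra ℚ G) q) ∈
      (MonoidAlgebra.mapRingHom G (PadicInt.Coe.ringHom (p := p))).range := by
  rw [MonoidAlgebra.coe_algebraMap, Function.comp_apply, Algebra.algebraMap_self_apply,
    MonoidAlgebra.mapRingHom_single]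
  exact single_algebraMap_mem_range_mapRingHom p 1 h

/-- `‖x·y‖_p ≤ 1` for `p`-integral rationals. [folklore] -/
theorem norm_ratCast_mul_le_one {x y : ℚ} (hx : ‖(x : ℚ_[p])‖ ≤ 1) (hy : ‖(y : ℚ_[p])‖ ≤ 1) :
    ‖((x * y : ℚ) : ℚ_[p])‖ ≤ 1 := by
  rw [Rat.cast_mul, norm_mul]
  exact mul_le_one₀ hx (norm_nonneg _) hy

/-- Integers are `p`-integral. [folklore] -/
theorem norm_ratCast_intCast_le_one (z : ℤ) : ‖(((z : ℚ)) : ℚ_[p])‖ ≤ 1 := by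
  rw [Rat.cast_intCast]
  exact Padic.norm_int_le_one z

/-- `‖m/q‖_p ≤ 1` for an integer `m` and a prime `q ≠ p`. [folklore] -/
theorem norm_ratCast_div_le_one_of_ne {q : ℕ} (hq : q.Prime) (hqp : q ≠ p) (m : ℤ) :
    ‖(((m : ℚ) / q : ℚ) : ℚ_[p])‖ ≤ 1 := by
  have h1 : ‖((q : ℤ) : ℚ_[p])‖ = 1 := by
    refine le_antisymm (Padic.norm_int_le_one _) (not_lt.mp fun hlt => ?_)
    have hdvd : (p : ℤ) ∣ q := Padic.norm_intCast_lt_one_iff.mp hlt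
    exact hqp ((Nat.prime_dvd_prime_iff_eq Fact.out hq).1 (by exact_mod_cast hdvd)).symm
  rw [Rat.cast_div, Rat.cast_intCast, Rat.cast_natCast, norm_div,
    show ((q : ℚ_[p])) = ((q : ℤ) : ℚ_[p]) by norm_cast, h1, div_one]
  exact Padic.norm_int_le_one m

end Lift

/-! ### §4 The integral lift `V` of the twist `Vq = (1 + δ₋₁)·uκ δ_{u⁻¹}·E·C⁻` -/

section Twist

open Literature.NumberTheory.EllipticCurves (ratMinusSymbol)

omit [NeZero n] in
/-- **The twist of PK-4b-C4b-2 (v) has an INTEGRAL LIFT `V ∈ ℤ_p[(ℤ/n)ˣ]`** as soon as the scalars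
it is built from are `p`-integral: `uκ`, `a_q/q` and `𝟙_{q∤N}/q` for `q ∣ M`, and the four cusp
symbols `[a/A]⁻, [ac/A]⁻, [ad′/A]⁻, [acd′/A]⁻` (its shape binders `hEq`/`hCq`/`hVq` are (v)'s, at any
level `n`).  The image of `ℤ_p[G] → ℚ_p[G]` is a subring containing these monomials. [folklore] -/
theorem exists_padicLift_twist {N₀ : ℕ} (f : CuspForm (CongruenceSubgroup.Gamma0 N₀) 2)
    (u : (ZMod n)ˣ) (uκ : ℚ) (M N : ℕ) (uq : ℕ → (ZMod n)ˣ) (aM : ℕ → ℤ)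
    (Eq : MonoidAlgebra ℚ (ZMod n)ˣ)
    (hEq : Eq = ∏ q ∈ M.primeFactors, (1 - MonoidAlgebra.single (uq q)⁻¹ ((aM q : ℚ) / q) +
      MonoidAlgebra.single ((uq q)⁻¹ ^ 2) (if q ∣ N then 0 else (1 / q : ℚ))))
    (c d a d' : ℤ) (A : ℕ) (uc ud : (ZMod n)ˣ)
    (Cq : MonoidAlgebra ℚ (ZMod n)ˣ)
    (hCq : Cq = algebraMap ℚ _ ((c : ℚ) ^ 2 * (d : ℚ) ^ 2 * ratMinusSymbol f ((a : ℚ) / A)) -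
      MonoidAlgebra.single uc ((c : ℚ) * (d : ℚ) ^ 2 * ratMinusSymbol f ((a * c : ℚ) / A)) -
      MonoidAlgebra.single ud ((c : ℚ) ^ 2 * (d : ℚ) * ratMinusSymbol f ((a * d' : ℚ) / A)) +
      MonoidAlgebra.single (uc * ud) ((c : ℚ) * (d : ℚ) * ratMinusSymbol f ((a * c * d' : ℚ) / A)))
    (Vq : MonoidAlgebra ℚ (ZMod n)ˣ)
    (hVq : Vq = (1 + MonoidAlgebra.single (-1 : (ZMod n)ˣ) (1 : ℚ)) * MonoidAlgebra.single u⁻¹ uκ * Eq * Cq)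
    (huκ : ‖(uκ : ℚ_[p])‖ ≤ 1)
    (haq : ∀ q ∈ M.primeFactors, ‖((((aM q : ℚ) / q : ℚ)) : ℚ_[p])‖ ≤ 1)
    (hNq : ∀ q ∈ M.primeFactors, ‖(((if q ∣ N then 0 else (1 / q : ℚ)) : ℚ) : ℚ_[p])‖ ≤ 1)
    (hs₁ : ‖((ratMinusSymbol f ((a : ℚ) / A) : ℚ) : ℚ_[p])‖ ≤ 1)
    (hs₂ : ‖((ratMinusSymbol f ((a * c : ℚ) / A) : ℚ) : ℚ_[p])‖ ≤ 1)
    (hs₃ : ‖((ratMinusSymbol f ((a * d' : ℚ) / A) : ℚ) : ℚ_[p])‖ ≤ 1)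
    (hs₄ : ‖((ratMinusSymbol f ((a * c * d' : ℚ) / A) : ℚ) : ℚ_[p])‖ ≤ 1) :
    ∃ V : MonoidAlgebra ℤ_[p] (ZMod n)ˣ,
      MonoidAlgebra.mapRingHom (ZMod n)ˣ (PadicInt.Coe.ringHom (p := p)) V =
        MonoidAlgebra.mapRingHom (ZMod n)ˣ (algebraMap ℚ ℚ_[p]) Vq := by
  -- the rational group-ring elements whose base change to `ℚ_p` comes from `ℤ_p[G]` form a subring
  let S : Subring (MonoidAlgebra ℚ (ZMod n)ˣ) :=
    (MonoidAlgebra.mapRingHom (ZMod n)ˣ (PadicInt.Coe.ringHom (p := p))).range.comap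
      (MonoidAlgebra.mapRingHom (ZMod n)ˣ (algebraMap ℚ ℚ_[p]))
  have hsingle : ∀ (g : (ZMod n)ˣ) {q : ℚ}, ‖(q : ℚ_[p])‖ ≤ 1 → MonoidAlgebra.single g q ∈ S :=
    fun g q h => Subring.mem_comap.mpr (by
      rw [MonoidAlgebra.mapRingHom_single]
      exact single_algebraMap_mem_range_mapRingHom p g h)
  have halg : ∀ {q : ℚ}, ‖(q : ℚ_[p])‖ ≤ 1 → algebraMap ℚ (MonoidAlgebra ℚ (ZMod n)ˣ) q ∈ S :=
    fun h => Subring.mem_comap.mpr (algebraMap_mem_range_mapRingHom p h)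
  suffices h : Vq ∈ S by
    obtain ⟨V, hV⟩ := Subring.mem_comap.mp h
    exact ⟨V, hV⟩
  have hc : ‖((c : ℚ) : ℚ_[p])‖ ≤ 1 := norm_ratCast_intCast_le_one p c
  have hd : ‖((d : ℚ) : ℚ_[p])‖ ≤ 1 := norm_ratCast_intCast_le_one p d
  have hc2 : ‖(((c : ℚ) ^ 2 : ℚ) : ℚ_[p])‖ ≤ 1 := by rw [sq]; exact norm_ratCast_mul_le_one p hc hc
  have hd2 : ‖(((d : ℚ) ^ 2 : ℚ) : ℚ_[p])‖ ≤ 1 := by rw [sq]; exact norm_ratCast_mul_le_one p hd hd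
  subst hVq hEq hCq
  refine mul_mem (mul_mem (mul_mem (add_mem (one_mem S) (hsingle _ ?_)) (hsingle _ huκ))
    (prod_mem fun q hq => add_mem (sub_mem (one_mem S) (hsingle _ (haq q hq))) (hsingle _ (hNq q hq))))
    (add_mem (sub_mem (sub_mem (halg ?_) (hsingle _ ?_)) (hsingle _ ?_)) (hsingle _ ?_))
  · rw [Rat.cast_one, norm_one]
  · exact norm_ratCast_mul_le_one p (norm_ratCast_mul_le_one p hc2 hd2) hs₁
  · exact norm_ratCast_mul_le_one p (norm_ratCast_mul_le_one p hc hd2) hs₂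
  · exact norm_ratCast_mul_le_one p (norm_ratCast_mul_le_one p hc2 hd) hs₃
  · exact norm_ratCast_mul_le_one p (norm_ratCast_mul_le_one p hc hd) hs₄

end Twist

end Summit.BirchSwinnertonDyer.Rank1Residual.GaloisImage.ValueRow

end
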